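import Literature.AlgebraicGeometry.Resolution.PrincipalRidgeLinearTame
import Literature.AlgebraicGeometry.Resolution.AdditiveFormsStructure
import HarnessLib

/-!
# The ridge of a cone defined by forms of one degree: intersection of the ridges of the generators; in tame degree it is
# a linear subspace (Giraud 1975 §1.5; BHM 2010 Prop.–Def. 2.1, Lemma 3.6; Schober 2021 Rem. 2.6)

Topic: `Literature/AlgebraicGeometry/Resolution`. Sequel of `Ridge.lean` / `RidgeRepresentable.lean` (Giraud's ridge
functor `ridge k' I = F(k') = {v | L_v(C ×_K k') ⊆ C ×_K k'}`, its ideal `𝔉 = ridgeIdeal I`, representability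
`F = V(𝔉)`) and of `PrincipalRidgeLinearTame.lean` (for ONE form of degree `d < p` the ridge ideal is generated by
the linear Hasse–Schmidt coefficients). The typical cone of resolution of singularities — the tangent cone of an ideal
exponent `(J, b)` at a point of order `b` — is cut out by the initial forms of degree EXACTLY `b` of `J`, i.e. by a
set `G` of forms of ONE degree. For such cones Giraud's definition unwinds completely:

> **Giraud 1975, §1.5 (1).** "`F(k') = {v ∈ V(k') | L_v(C ×_k k') ⊂ C ×_k k'}`". **BHM 2010, Prop.–Def. 2.1 (proof).**
> "`v ∈ F(B)` if and only if `f_i(X + v) ∈ I ⊗ B` for the generators `f_i` of `I`".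

PROVED here (every characteristic; `K` a field, `k'` any commutative `K`-algebra):
* `coeff_eq_zero_of_mem_coneIdeal_span` — the cone ideal `⟨G⟩ · k'[X]` has no coefficients in degree `< b`;
* `coeff_shift_map_of_degree_eq` — translation does not change the top-degree coefficients of a form
  (`f(X + v) = Σ_A D_A f(X) v^A`, `RidgeRepresentable.shift_map_eq_sum_taylorY`);
* **`mem_ridge_span_iff_forall_shift_map_eq`** — for `I = ⟨G⟩`, `G` forms of degree `b`:
  `v ∈ F(k') ⟺ g(X + v) = g(X)` for every `g ∈ G` (the low-degree Taylor terms of `g(X + v)` must lie in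
  `I · k'[X]`, which starts in degree `b`), hence **`ridge_span_eq_iInf`**: `F(⟨G⟩) = ⋂_{g ∈ G} F(⟨g⟩)` and, by
  representability and the universal point, **`ridgeIdeal_span_eq_iSup`**: `𝔉(⟨G⟩) = Σ_{g ∈ G} 𝔉(⟨g⟩)`;
* TAME DEGREE (`1, …, b` non-zero in `K`: characteristic `0` or `p > b`): **`ridgeIdeal_span_eq_span_linearHasse`** —
  `𝔉(⟨G⟩) = ⟨D_A g : g ∈ G, |A| + 1 = b⟩` is generated by LINEAR forms (the ridge of the cone is a vector subspace of
  the tangent space, «`Rid = Dir`-type behaviour», BHM Lemma 3.6 / Algorithm 3.5 with `𝓔_p = 𝓔_1`; Schober Rem. 2.6),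
  with `…_of_lt_char` (`[CharP K p]`, `b < p`) and `…_of_charZero`; `isHomogeneous_one_of_mem_linearHasseSet`.

Written for the cell res-hironaka (seat res-L1-s46-pv-7, W4.6 rung (iv): «large `p` relative to the degree» — the
regime `p > b` in which the tangent-cone steps of the procedure behave as in characteristic zero). AI-written; AI
review is weaker than expert review.

## References

* J. Giraud, *Contact maximal en caractéristique positive*, Ann. Sci. ÉNS (4) 8 (1975), §1.5. [Giraud1975]
* J. Berthomieu, P. Hivert, H. Mourtada, *Computing Hironaka's invariants: ridge and directrix*, Contemp. Math. 521
  (2010), Prop.–Def. 2.1, Lemma 3.6, Algorithm 3.5. [BerthomieuHivertMourtada2010]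
* B. Schober, *Idealistic exponents: tangent cone, ridge, characteristic polyhedra*, J. Algebra 565 (2021), Rem. 2.6.
  [Schober2021IdealisticExponents]
-/

noncomputable section

open MvPolynomial
open Literature.RingTheory.MvPolynomial

namespace Literature.AlgebraicGeometry.Resolution

universe u v

variable {K : Type u} [Field K] {n : ℕ}

/-! ## 1. Cones defined in one degree -/

section EqualDegree

variable {G : Set (MvPolynomial (Fin n) K)} {b : ℕ}
variable {k' : Type v} [CommRing k'] [Algebra K k']

/-- The cone ideal `⟨G⟩ · k'[X]` is spanned over `k'[X]` by the `g ⊗ 1`, `g ∈ G`. [cite: Giraud1975, §1.5] -/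
theorem coneIdeal_span_eq (G : Set (MvPolynomial (Fin n) K)) :
    coneIdeal k' (Ideal.span G) = Ideal.span (MvPolynomial.map (algebraMap K k') '' G) := by
  rw [coneIdeal, Ideal.map_span]

/-- **A cone defined in degree `b` has no equations of lower degree**: every element of `⟨G⟩ · k'[X]`, `G` a set of
forms of degree `b`, has vanishing coefficients in all degrees `< b`. [cite: Giraud1975, §1.5] -/
theorem coeff_eq_zero_of_mem_coneIdeal_span (hG : ∀ g ∈ G, g.IsHomogeneous b) {q : MvPolynomial (Fin n) k'}
    (hq : q ∈ coneIdeal k' (Ideal.span G)) {m : Fin n →₀ ℕ} (hm : m.degree < b) : coeff m q = 0 := by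
  classical
  rw [coneIdeal_span_eq] at hq
  suffices H : ∀ m : Fin n →₀ ℕ, m.degree < b → coeff m q = 0 from H m hm
  refine Submodule.span_induction (p := fun q _ => ∀ m : Fin n →₀ ℕ, m.degree < b → coeff m q = 0)
    ?_ ?_ ?_ ?_ hq
  · rintro _ ⟨g, hg, rfl⟩ m hm
    rw [coeff_map, (hG g hg).coeff_eq_zero hm.ne, map_zero]
  · intro m _; rw [coeff_zero]
  · intro x y _ _ hx hy m hm; rw [coeff_add, hx m hm, hy m hm, add_zero]
  · intro t x _ hx m hm
    rw [smul_eq_mul, coeff_mul]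
    refine Finset.sum_eq_zero fun a ha => ?_
    rw [Finset.mem_antidiagonal] at ha
    have hdeg : a.2.degree ≤ m.degree := by
      rw [← ha, map_add]; exact Nat.le_add_left _ _
    rw [hx a.2 (lt_of_le_of_lt hdeg hm), mul_zero]

/-- The Taylor coefficients of `RidgeRepresentable.taylorY` are the Hasse–Schmidt derivatives. [folklore] -/
private theorem coeff_taylorY (A : Fin n →₀ ℕ) (g : MvPolynomial (Fin n) K) : coeff A (taylorY K n g) = hasseDeriv K A g :=
  rfl

/-- **Translations do not change the top-degree coefficients of a form**: for `g` homogeneous of degree `b` and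
`|m| = b`, `coeff_m g(X + v) = coeff_m g` (in `g(X + v) = Σ_A D_A g(X) v^A` only `A = 0` contributes in degree `b`).
[cite: BerthomieuHivertMourtada2010, Prop. 2.1 (proof)] -/
theorem coeff_shift_map_of_degree_eq {g : MvPolynomial (Fin n) K} (hg : g.IsHomogeneous b) (v : Fin n → k')
    {m : Fin n →₀ ℕ} (hm : m.degree = b) :
    coeff m (shift v (MvPolynomial.map (algebraMap K k') g)) = algebraMap K k' (coeff m g) := by
  classical
  rw [shift_map_eq_sum_taylorY, coeff_sum]
  have hterm : ∀ A ∈ (taylorY K n g).support,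
      coeff m (MvPolynomial.map (algebraMap K k') (coeff A (taylorY K n g)) * C (∏ i ∈ A.support, v i ^ A i)) =
        if A = 0 then algebraMap K k' (coeff m g) else 0 := by
    intro A _
    rw [mul_comm, coeff_C_mul, mul_comm, coeff_map, coeff_taylorY]
    split_ifs with hA
    · rw [hA, hasseDeriv_zero_apply, Finsupp.support_zero, Finset.prod_empty, mul_one]
    · rw [coeff_hasseDeriv, hg.coeff_eq_zero, mul_zero, map_zero, zero_mul]
      rw [map_add, hm]
      have : A.degree ≠ 0 := fun h0 => hA ((Finsupp.degree_eq_zero_iff A).mp h0)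
      omega
  rw [Finset.sum_congr rfl hterm, Finset.sum_ite_eq']
  split_ifs with h0
  · rfl
  · -- `0 ∉ supp g(X + Y)` means `g = D_0 g = 0`
    have hg0 : g = 0 := by
      have := notMem_support_iff.mp h0
      rwa [coeff_taylorY, hasseDeriv_zero_apply] at this
    rw [hg0, coeff_zero, map_zero]

/-- **Points of the ridge translate each generator into itself**: for `I = ⟨G⟩` with `G` forms of degree `b` and
`v ∈ F(k')`, `g(X + v) = g(X)` for every `g ∈ G` (the lower Taylor terms lie in `I · k'[X]`, which has nothing below
degree `b`). [cite: Giraud1975, §1.5] [cite: BerthomieuHivertMourtada2010, Prop. 2.1 (proof)] -/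
theorem shift_map_eq_of_mem_ridge_span (hG : ∀ g ∈ G, g.IsHomogeneous b) {v : Fin n → k'}
    (hv : v ∈ ridge k' (Ideal.span G)) {g : MvPolynomial (Fin n) K} (hg : g ∈ G) :
    shift v (MvPolynomial.map (algebraMap K k') g) = MvPolynomial.map (algebraMap K k') g := by
  classical
  rcases subsingleton_or_nontrivial k' with hk | hk
  · exact Subsingleton.elim _ _
  have hmem : shift v (MvPolynomial.map (algebraMap K k') g) ∈ coneIdeal k' (Ideal.span G) :=
    (mem_ridge_iff_forall_mem.mp hv) g (Ideal.subset_span hg)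
  ext m
  rcases lt_trichotomy m.degree b with hlt | heq | hgt
  · rw [coeff_eq_zero_of_mem_coneIdeal_span hG hmem hlt, coeff_map, (hG g hg).coeff_eq_zero hlt.ne, map_zero]
  · rw [coeff_shift_map_of_degree_eq (hG g hg) v heq, coeff_map]
  · have hdeg : (MvPolynomial.map (algebraMap K k') g).totalDegree < ∑ i ∈ m.support, m i := by
      rw [← Finsupp.degree_apply]
      exact lt_of_le_of_lt ((hG g hg).map (algebraMap K k')).totalDegree_le hgt
    rw [coeff_eq_zero_of_totalDegree_lt hdeg,
      coeff_eq_zero_of_totalDegree_lt (lt_of_le_of_lt (totalDegree_shift_le v _) hdeg)]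

/-- Conversely, translation invariance of the generators puts `v` in the ridge. [cite: Giraud1975, §1.5] -/
theorem mem_ridge_span_of_forall_shift_map_eq {v : Fin n → k'}
    (h : ∀ g ∈ G, shift v (MvPolynomial.map (algebraMap K k') g) = MvPolynomial.map (algebraMap K k') g) :
    v ∈ ridge k' (Ideal.span G) := by
  rw [mem_ridge_iff, coneIdeal_span_eq]
  have hle : Ideal.span (MvPolynomial.map (algebraMap K k') '' G) ≤
      (Ideal.span (MvPolynomial.map (algebraMap K k') '' G)).comap (shift v).toRingHom := by
    refine Ideal.span_le.mpr ?_
    rintro _ ⟨g, hg, rfl⟩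
    rw [SetLike.mem_coe, Ideal.mem_comap, AlgHom.toRingHom_eq_coe, RingHom.coe_coe, h g hg]
    exact Ideal.subset_span ⟨g, hg, rfl⟩
  exact fun f hf => hle hf

/-- **The ridge of a cone defined in one degree**: for `I = ⟨G⟩`, `G` a set of forms of degree `b`, and every
commutative `K`-algebra `k'`, `v ∈ F(k') ⟺ g(X + v) = g(X)` for all `g ∈ G`. [cite: Giraud1975, §1.5]
[cite: BerthomieuHivertMourtada2010, Prop. 2.1 (proof)] -/
theorem mem_ridge_span_iff_forall_shift_map_eq (hG : ∀ g ∈ G, g.IsHomogeneous b) {v : Fin n → k'} :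
    v ∈ ridge k' (Ideal.span G) ↔
      ∀ g ∈ G, shift v (MvPolynomial.map (algebraMap K k') g) = MvPolynomial.map (algebraMap K k') g :=
  ⟨fun hv _ hg => shift_map_eq_of_mem_ridge_span hG hv hg, mem_ridge_span_of_forall_shift_map_eq⟩

/-- **`F(⟨G⟩) = ⋂_{g ∈ G} F(⟨g⟩)`**: the ridge of a cone defined by forms of one degree is the intersection of the ridges
of the hypersurface cones of its generators (as subgroup functors). [cite: Giraud1975, §1.5] -/
theorem ridge_span_eq_iInf (hG : ∀ g ∈ G, g.IsHomogeneous b) :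
    ridge k' (Ideal.span G) = ⨅ g ∈ G, ridge k' (Ideal.span {g}) := by
  ext v
  simp only [AddSubmonoid.mem_iInf]
  rw [mem_ridge_span_iff_forall_shift_map_eq hG]
  refine forall₂_congr fun g hg => ?_
  rw [mem_ridge_span_iff_forall_shift_map_eq (b := b) (fun g' hg' => by rw [Set.mem_singleton_iff.mp hg']; exact hG g hg)]
  simp only [Set.mem_singleton_iff, forall_eq]

/-- **`𝔉(⟨G⟩) = Σ_{g ∈ G} 𝔉(⟨g⟩)`**: the ideal of the ridge of a cone defined by forms of one degree is the sum of the
ridge ideals of its generators (representability `F = V(𝔉)` and the universal point of `V(Σ 𝔉(⟨g⟩))`).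
[cite: Giraud1975, §1.5] [cite: BerthomieuHivertMourtada2010, Prop. 2.1] -/
theorem ridgeIdeal_span_eq_iSup (hG : ∀ g ∈ G, g.IsHomogeneous b) :
    ridgeIdeal (Ideal.span G) = ⨆ g ∈ G, ridgeIdeal (Ideal.span {g}) := by
  apply le_antisymm
  · intro f hf
    set J : Ideal (MvPolynomial (Fin n) K) := ⨆ g ∈ G, ridgeIdeal (Ideal.span {g}) with hJ
    -- the universal point of `V(J)` lies in every `F(⟨g⟩)`, hence in `F(⟨G⟩)`
    have hv : (fun j => Ideal.Quotient.mk J (X j : MvPolynomial (Fin n) K)) ∈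
        ridge (MvPolynomial (Fin n) K ⧸ J) (Ideal.span G) := by
      rw [ridge_span_eq_iInf hG, AddSubmonoid.mem_iInf]
      intro g
      rw [AddSubmonoid.mem_iInf]
      intro hg
      refine mem_ridge_iff_forall_ridgeIdeal.mpr fun f' hf' => ?_
      rw [aeval_mk_X, Ideal.Quotient.eq_zero_iff_mem]
      exact (le_iSup₂ (f := fun g _ => ridgeIdeal (Ideal.span {g})) g hg) hf'
    have h0 := hf _ _ hv
    rwa [aeval_mk_X, Ideal.Quotient.eq_zero_iff_mem] at h0
  · refine iSup₂_le fun g hg f hf => ?_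
    intro k'' _ _ v hv
    rw [ridge_span_eq_iInf hG, AddSubmonoid.mem_iInf] at hv
    have hv' := hv g
    rw [AddSubmonoid.mem_iInf] at hv'
    exact hf k'' v (hv' hg)

end EqualDegree

/-! ## 2. Tame degree: the ridge of a cone defined in degree `b < p` is a linear subspace -/

section Tame

variable {G : Set (MvPolynomial (Fin n) K)} {b : ℕ}

variable (G b) in
/-- The LINEAR Hasse–Schmidt coefficients `D_A g`, `g ∈ G`, `|A| + 1 = b`, of a set of forms of degree `b`
(BHM's `𝓔_1`, Algorithm 3.5). [cite: BerthomieuHivertMourtada2010, Algorithm 3.5] -/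
def linearHasseSet : Set (MvPolynomial (Fin n) K) :=
  {l | ∃ g ∈ G, ∃ A : Fin n →₀ ℕ, A.degree + 1 = b ∧ l = hasseDeriv K A g}

/-- The linear Hasse–Schmidt coefficients are linear forms. [cite: BerthomieuHivertMourtada2010, Algorithm 3.5] -/
theorem isHomogeneous_one_of_mem_linearHasseSet (hG : ∀ g ∈ G, g.IsHomogeneous b) {l : MvPolynomial (Fin n) K}
    (hl : l ∈ linearHasseSet G b) : l.IsHomogeneous 1 := by
  classical
  obtain ⟨g, hg, A, hA, rfl⟩ := hl
  have h := isHomogeneous_hasseDeriv_of_isHomogeneous (hG g hg) A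
  rwa [show b - A.degree = 1 by omega] at h

/-- **Tame degree: the ridge ideal of a cone defined in one degree is linear.** For a set `G` of forms of degree `b`
over a field `K` in which `1, …, b` are non-zero (characteristic `0`, or `p > b`):
`𝔉(⟨G⟩) = ⟨D_A g : g ∈ G, |A| + 1 = b⟩` — generated by LINEAR forms; the ridge of the cone is a vector subspace of
the tangent space (no wild additive equations `Σ c_i X_i^{p^e}`, `e ≥ 1`). [cite: BerthomieuHivertMourtada2010, Lemma 3.6]
[cite: Schober2021IdealisticExponents, Rem. 2.6] -/
theorem ridgeIdeal_span_eq_span_linearHasseSet (hG : ∀ g ∈ G, g.IsHomogeneous b)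
    (hchar : ∀ m : ℕ, 1 ≤ m → m ≤ b → (m : K) ≠ 0) :
    ridgeIdeal (Ideal.span G) = Ideal.span (linearHasseSet G b) := by
  rw [ridgeIdeal_span_eq_iSup hG]
  apply le_antisymm
  · refine iSup₂_le fun g hg => ?_
    rw [ridgeIdeal_span_singleton_eq_span_linearHasse (hG g hg) hchar]
    refine Ideal.span_mono ?_
    rintro _ ⟨A, hA, rfl⟩
    exact ⟨g, hg, A, hA, rfl⟩
  · refine Ideal.span_le.mpr ?_
    rintro _ ⟨g, hg, A, hA, rfl⟩
    have hmem : hasseDeriv K A g ∈ ridgeIdeal (Ideal.span {g}) := by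
      rw [ridgeIdeal_span_singleton_eq_span_linearHasse (hG g hg) hchar]
      exact Ideal.subset_span ⟨A, hA, rfl⟩
    exact (le_iSup₂ (f := fun g _ => ridgeIdeal (Ideal.span {g})) g hg) hmem

/-- **Characteristic `p > b`** (`[CharP K p]`): the ridge ideal of a cone defined by forms of degree `b < p` is generated
by linear forms. [cite: BerthomieuHivertMourtada2010, Lemma 3.6] -/
theorem ridgeIdeal_span_eq_span_linearHasseSet_of_lt_char (p : ℕ) [CharP K p] (hG : ∀ g ∈ G, g.IsHomogeneous b)
    (hbp : b < p) : ridgeIdeal (Ideal.span G) = Ideal.span (linearHasseSet G b) := by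
  refine ridgeIdeal_span_eq_span_linearHasseSet hG fun m h1 hm => ?_
  rw [Ne, CharP.cast_eq_zero_iff K p m]
  exact fun hdvd => absurd (Nat.le_of_dvd (by omega) hdvd) (by omega)

/-- **Characteristic `0`**: the ridge ideal of a cone defined by forms of one degree is generated by linear forms
(«`Rid = Dir`», Schober Rem. 2.6). [cite: Schober2021IdealisticExponents, Rem. 2.6] -/
theorem ridgeIdeal_span_eq_span_linearHasseSet_of_charZero [CharZero K] (hG : ∀ g ∈ G, g.IsHomogeneous b) :
    ridgeIdeal (Ideal.span G) = Ideal.span (linearHasseSet G b) :=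
  ridgeIdeal_span_eq_span_linearHasseSet hG fun m h1 _ => by exact_mod_cast (by omega : m ≠ 0)

/-- **In tame degree the ridge ideal is generated by its own linear forms** (`𝔉 = 𝔉_1 · S`).
[cite: Schober2021IdealisticExponents, Rem. 2.6] -/
theorem ridgeIdeal_span_eq_span_inter_isHomogeneous_one (hG : ∀ g ∈ G, g.IsHomogeneous b)
    (hchar : ∀ m : ℕ, 1 ≤ m → m ≤ b → (m : K) ≠ 0) :
    ridgeIdeal (Ideal.span G) =
      Ideal.span {l | l ∈ ridgeIdeal (Ideal.span G) ∧ l.IsHomogeneous 1} := by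
  refine le_antisymm ?_ (Ideal.span_le.mpr fun l hl => hl.1)
  conv_lhs => rw [ridgeIdeal_span_eq_span_linearHasseSet hG hchar]
  refine Ideal.span_mono fun l hl => ⟨?_, isHomogeneous_one_of_mem_linearHasseSet hG hl⟩
  rw [ridgeIdeal_span_eq_span_linearHasseSet hG hchar]
  exact Ideal.subset_span hl

/-- **Tame degree: the points of the ridge form a `K`-linear system.** For `G` forms of degree `b`, `1, …, b` non-zero
in `K`, and any commutative `K`-algebra `k'` (universe of `K`): `v ∈ F(k')` iff every linear Hasse coefficient
vanishes at `v`. [cite: BerthomieuHivertMourtada2010, Lemma 3.6] -/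
theorem mem_ridge_span_iff_forall_linearHasseSet {k' : Type u} [CommRing k'] [Algebra K k']
    (hG : ∀ g ∈ G, g.IsHomogeneous b) (hchar : ∀ m : ℕ, 1 ≤ m → m ≤ b → (m : K) ≠ 0) (v : Fin n → k') :
    v ∈ ridge k' (Ideal.span G) ↔ ∀ l ∈ linearHasseSet G b, aeval v l = 0 := by
  rw [mem_ridge_iff_forall_ridgeIdeal, ridgeIdeal_span_eq_span_linearHasseSet hG hchar]
  constructor
  · exact fun h l hl => h l (Ideal.subset_span hl)
  · intro h l hl
    have hle : Ideal.span (linearHasseSet G b) ≤ RingHom.ker ((aeval v).toRingHom) :=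
      Ideal.span_le.mpr fun l' hl' => h l' hl'
    exact hle hl

end Tame

end Literature.AlgebraicGeometry.Resolution

end
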